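import Literature.NumberTheory.Automorphic.Liu2021.AppendixC.AlbaneseTraceOfFiniteQuotientOfCocycle
import Literature.NumberTheory.Automorphic.Liu2021.AlbaneseBaseChangeProductCompat
import Literature.AlgebraicGeometry.Motives.JacobianGaloisCoverNorm
import Literature.AlgebraicGeometry.Motives.JacobianGaloisCoverNormAdjoint
import HarnessLib

/-!
# The pull-back `p^*` of a Galois cover of curves EXISTS on Jacobians, in its def-free form `Nm_p ≫ t = Σ_δ δ_*`
# (Lang VIII §6 Thm. 13 on Albanese varieties, read on Milne's Jacobians through Liu's Albanese data; LR22 Prop. 3.5.1)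

Topic `NumberTheory/Automorphic/Liu2021/AppendixC`; namespace `Literature.NumberTheory.Automorphic.Liu2021.AppendixC`.
PROOF FILE (theorems only; no definition, no named fact, no instance, no `sorry`).

The tree's point-free Jacobian `Motives.Jacobian X` (the pair `(J, diff)` with Milne's universal property) carries the norm maps
`Nm_f = Jacobian.pushforward` ([Lange2023AbelianVarietiesComplex] §4.5.2) but NOT the pull-back `f^*` (Picard functoriality is
deferred).  For a Galois cover `p : X → Y = X/Δ` the pull-back is characterised without the dual by
[LangeRodriguez2022] Prop. 3.5.1 «`Nm_G = f^* ∘ Nm_f`», i.e. `t = p^*` iff **`Nm_p ≫ t = Σ_{δ ∈ Δ} δ_*`** — the shape in which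
★ Q1 `Jacobian.comp_pushforward_eq_card_zsmul` (`t ≫ Nm_p = |Δ|`), the named fact ★ (F-P2)
`Jacobian.galoisCover_pullback_isWeilPairingAdjoint_norm` (`t` is the `ē_N`-adjoint of `Nm_p`), ★ (P3) `heckeEnd_eq_pushPull_of_aut` and
★ `Jacobian.trace_baseChange_comm` all take `t` AS A HYPOTHESIS.  This file PRODUCES it:

* §1 `Albanese.exists_onePiece` — a geometrically irreducible `X` with a Jacobian `𝒥` carries a Liu Albanese datum
  ([Liu2021] Def. 2.3) `a` with `∇X = X × X`, `Alb_X ≅ J` (`i : J ⟶ Alb`, `π : Alb ⟶ J` inverse to each other) and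
  `α_X = diff ≫ i` (★ `Albanese.exists_of_isColimit_compat` at ONE piece);
* §2 **`Albanese.inj_comp_map_comp_proj_eq_pushforward`** — on such data, Liu's Albanese map IS Milne's norm map:
  `i_X ≫ Alb_f ≫ π_Y = Nm_f` (the one-piece, base-change-free case of ★ (N1) `Albanese.inj_comp_map_baseChange_eq_pushforward_comp_inj`);
* §3 **`Jacobian.exists_pushforward_comp_eq_sum`** — for smooth projective geometrically irreducible `X`, `Y` over a field
  `k ⊆ ℂ` (any dimensions), a finite group `Δ` acting on `X` and a quotient `p : X ⟶ Y` for separated test objects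
  (`IsSepQuotient`): **`∃ t : J_Y ⟶ J_X, Nm_p ≫ t = Σ_δ (act δ)_*`** — [Lang1983AbelianVarieties] VIII §6 Thm. 13 (the trace
  `h_*` with `h_* f_* = Σ_g g_*`), = ★ `Albanese.exists_trace_of_isSepQuotient_complex` transported through §2;
* §4 **`Jacobian.exists_galoisCover_letters`** — the (F-P2) PACKAGE of a Galois cover of smooth projective complex CURVES with
  Riemann principal theta divisors: `∃ t`, (pin) `Nm_p ≫ t = Σ_δ δ_*` ∧ (degree) `t ≫ Nm_p = |Δ| • 𝟙` ∧ (adjoint)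
  `ē_N^{Θ_X}(t P, Q) = ē_N^{Θ_Y}(P, Nm_p Q)` for all levels — the three hypotheses `ht`/`hdeg`/`hq` of the level-adjoint calculus
  (★ `levelAdjoint_pushPull`, ★ `JacobianCorrespondenceLevelAdjoint` ed. 2) DISCHARGED, given the named fact (F-P2) as a hypothesis.

Cell `hodgecm-mathlib` (D-0151), crux `HLiu418` = stmt-HodgeConjecture-24832, d6 line, `stub_RosH` glue, piece (L3) «entrywise
instances» (A-plan2 (g12) / A-p18 (g11) 2026-08-30): every letter of the complex Hecke words is a norm or a pinned pull-back along a
PIECE of a Galois level cover (★ `exists_subgroup_isSepQuotient_pieceMap'`: quotient by the stabiliser `H ≤ Aut`, `act := H.subtype`),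
and §4 is what the (L) assembler consumes per piece.  COUNT-NEUTRAL capital: HC_CM is proved only modulo the 7 printed citations until
rung 0 closes; §4 is conditional on the named fact it takes as a hypothesis.

## References
* [Lang1983AbelianVarieties] S. Lang, *Abelian Varieties* (1983), Ch. VIII §6 Thm. 13 (pp. 224–227: the trace `h_*`, `f_* h_* = m·δ`).
* [LangeRodriguez2022] H. Lange, R. E. Rodríguez, *Decomposition of Jacobians by Prym Varieties*, LNM 2310 (2022), §3.5.1 Prop. 3.5.1
  (p. 65) «`Nm_G = f^* ∘ Nm_f`»; §3.2.1 eq. (3.3) (pp. 46–47).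
* [Liu2021] Y. Liu, *Fourier–Jacobi cycles and arithmetic relative trace formula*, Camb. J. Math. 9 (2021): §2.1 Proposition
  (FJcycle.tex l. 1190–1200), Def. 2.3 (l. 1202–1208).
* [Lange2023AbelianVarietiesComplex] H. Lange, *Abelian Varieties over the Complex Numbers* (2023), §4.5.2 (the norm map `N_f`), eq. (4.9).
* [Milne1986JacobianVarieties] J. S. Milne, *Jacobian Varieties* (1986), §6 Prop. 6.4, Remark 6.5.
-/

set_option autoImplicit false

noncomputable section

open CategoryTheory CategoryTheory.Limits AlgebraicGeometry MonoidalCategory CartesianMonoidalCategory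
open Literature.AlgebraicGeometry.Motives

universe v

namespace Literature.NumberTheory.Automorphic.Liu2021.AppendixC

/-! ## §1 The one-piece Albanese datum of a geometrically irreducible scheme with a Jacobian -/

/-- **A geometrically irreducible `X` with a Jacobian `𝒥` has a Liu Albanese datum with `∇X = X × X`, `Alb_X ≅ J` and
`α_X = diff ≫ i`**: the one-piece case (`X = ∐_{PUnit} X`) of ★ `Albanese.exists_of_isColimit_compat` ([Liu2021] §2.1, proof of the
Proposition: `Alb_{X'} = ∏ᵢ Alb_{Xᵢ}`, the Albanese morphism is `diff_i ≫ ι_i` on `X_i × X_i`), with the biproduct laws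
`i ≫ π = 𝟙`, `π ≫ i = 𝟙` (the sum over `PUnit`) and the chart `l : X × X ⟶ ∇X` over `𝟙 × 𝟙`.
[cite: Liu2021, §2.1 Proposition, proof (FJcycle.tex l. 1194–1200), Def. 2.3 (l. 1202–1208)] [cite: Milne1986JacobianVarieties, §6 Prop. 6.4 and Remark 6.5] -/
theorem Albanese.exists_onePiece {k : Type} [Field k] {X : SchemeOver k} (𝒥 : Jacobian X)
    (hirr : GeometricallyIrreducible X.hom) :
    ∃ (a : Albanese X) (π : a.Alb ⟶ 𝒥.J) (i : 𝒥.J ⟶ a.Alb) (l : X ⊗ X ⟶ a.nabla.N),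
      i ≫ π = 𝟙 _ ∧ π ≫ i = 𝟙 _ ∧ l ≫ a.nabla.incl = 𝟙 _ ∧ l ≫ a.α = 𝒥.diff ≫ i.hom.hom.hom := by
  have hcol : IsColimit (Cofan.mk X (fun _ : PUnit.{1} => 𝟙 X)) :=
    Cofan.IsColimit.mk _ (fun s => s.inj PUnit.unit) (fun _ ⟨⟩ => Category.id_comp _)
      (fun _ m hm => (Category.id_comp m).symm.trans (hm PUnit.unit))
  obtain ⟨a, π, i, l, -, hiπ, -, htot, hl, hα⟩ :=
    Albanese.exists_of_isColimit_compat (κ := PUnit.{1}) (Y := fun _ => X) (inj := fun _ => 𝟙 X) hcol (fun _ => 𝒥)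
      (fun _ => hirr)
  refine ⟨a, π PUnit.unit, i PUnit.unit, l PUnit.unit, hiπ _, ?_, ?_, hα _⟩
  · rw [Fintype.sum_unique] at htot
    exact htot
  · rw [hl, id_tensorHom_id]

/-! ## §2 On one-piece data Liu's Albanese map is Milne's norm map -/

/-- **`i_X ≫ Alb_f ≫ π_Y = Nm_f`**: for one-piece Albanese data on `X` and `Y` (charts `l` over `𝟙 × 𝟙`, `α = diff ≫ i`, `i_Y ≫ π_Y = 𝟙`)
and any `f : X ⟶ Y`, Liu's Albanese map `Alb_f` ([Liu2021] Def. 2.3: `Alb_f ∘ α_X = α_Y ∘ ∇f`) conjugated to the Jacobians is the norm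
map `Nm_f` ([Lange2023AbelianVarietiesComplex] §4.5.2: `N_f` is THE homomorphism with `diff_X ≫ N_f = (f × f) ≫ diff_Y`,
★ `Jacobian.diff_comp_pushforward`).  Proof: both agree after `diff_X` (★ `Jacobian.hom_ext`); `∇f` is `f × f` through the charts since
`∇Y ↪ Y × Y` is a monomorphism (★ `Nabla.map_incl`). [cite: Liu2021, Def. 2.3 (FJcycle.tex l. 1206–1208) and §2.1 proof of the Proposition (l. 1194–1200)]
[cite: Lange2023AbelianVarietiesComplex, §4.5.2 (the norm map N_f)] [cite: Milne1986JacobianVarieties, §6 Prop. 6.4] -/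
theorem Albanese.inj_comp_map_comp_proj_eq_pushforward {k : Type} [Field k] {X Y : SchemeOver k}
    (𝒥X : Jacobian X) (𝒥Y : Jacobian Y) (aX : Albanese X) (aY : Albanese Y)
    (iX : 𝒥X.J ⟶ aX.Alb) (lX : X ⊗ X ⟶ aX.nabla.N) (πY : aY.Alb ⟶ 𝒥Y.J) (iY : 𝒥Y.J ⟶ aY.Alb) (lY : Y ⊗ Y ⟶ aY.nabla.N)
    (hlX : lX ≫ aX.nabla.incl = 𝟙 _) (hαX : lX ≫ aX.α = 𝒥X.diff ≫ iX.hom.hom.hom)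
    (hlY : lY ≫ aY.nabla.incl = 𝟙 _) (hαY : lY ≫ aY.α = 𝒥Y.diff ≫ iY.hom.hom.hom) (hiπY : iY ≫ πY = 𝟙 _)
    (f : X ⟶ Y) :
    iX ≫ aX.map aY f ≫ πY = 𝒥X.pushforward 𝒥Y f := by
  -- `∇f` through the charts: `l_X ≫ ∇f = (f × f) ≫ l_Y`
  haveI : Mono aY.nabla.incl := by
    haveI : IsOpenImmersion aY.nabla.incl.left := aY.nabla.isOpenImmersion_incl
    exact Over.mono_of_mono_left _
  have hnab : lX ≫ aX.nabla.map aY.nabla f = (f ⊗ₘ f) ≫ lY := by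
    rw [← cancel_mono aY.nabla.incl, Category.assoc, Nabla.map_incl, ← Category.assoc, hlX, Category.id_comp, Category.assoc,
      hlY, Category.comp_id]
  apply 𝒥X.hom_ext
  change 𝒥X.diff ≫ iX.hom.hom.hom ≫ (aX.map aY f).hom.hom.hom ≫ πY.hom.hom.hom = 𝒥X.diff ≫ (𝒥X.pushforward 𝒥Y f).hom.hom.hom
  rw [𝒥X.diff_comp_pushforward, ← Category.assoc 𝒥X.diff, ← hαX, Category.assoc, aX.α_map_assoc aY f, ← Category.assoc lX, hnab,
    Category.assoc, ← Category.assoc lY, hαY, Category.assoc]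
  congr 1
  rw [show iY.hom.hom.hom ≫ πY.hom.hom.hom = (iY ≫ πY).hom.hom.hom from rfl, hiπY]
  exact Category.comp_id _

/-! ## §3 The pinned pull-back of a Galois cover exists on Jacobians -/

/-- **`∃ t : J_Y ⟶ J_X, Nm_p ≫ t = Σ_δ (act δ)_*`** — the pull-back `p^*` of a Galois cover in its def-free form
([LangeRodriguez2022] Prop. 3.5.1 «`Nm_G = f^* ∘ Nm_f`»): for `X`, `Y` smooth projective geometrically irreducible over a field
`k ⊆ ℂ` (any dimensions), a finite group `Δ` acting on `X` by `act`, and `p : X ⟶ Y` a quotient for separated test objects.  This is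
[Lang1983AbelianVarieties] VIII §6 Thm. 13 (the trace `h_* : A(V) → A(U)` with `h_* ∘ f_* = Σ_g g_*`) — in the tree ★
`Albanese.exists_trace_of_isSepQuotient_complex` for Liu's Albanese data — transported to the Jacobians along the one-piece data
of §1 by §2 (`Alb_p`, `Alb_{act δ}` are `Nm_p`, `(act δ)_*` conjugated by `i`, `π`).  Uniqueness of `t` and `t ≫ Nm_p = |Δ|` are ★ Q1
(`Jacobian.eq_of_pushforward_comp_eq_sum`, `comp_pushforward_eq_card_zsmul`). [cite: Lang1983AbelianVarieties, Ch. VIII §6, Thm. 13 (pp. 224–227)]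
[cite: LangeRodriguez2022, §3.5.1 Prop. 3.5.1 (p. 65)] [cite: Liu2021, Def. 2.3 (FJcycle.tex l. 1202–1208)] -/
theorem Jacobian.exists_pushforward_comp_eq_sum {k : Type} [Field k] [CharZero k] [Algebra k ℂ] {X Y : SchemeOver k}
    {dX dY : ℕ} (hX : IsSmoothProjective dX X) (hY : IsSmoothProjective dY Y) (𝒥X : Jacobian X) (𝒥Y : Jacobian Y)
    {Δ : Type v} [Group Δ] [Fintype Δ] (act : Δ →* Aut X) (p : X ⟶ Y) (hp : IsSepQuotient (fun δ => act δ) p) :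
    ∃ t : 𝒥Y.J ⟶ 𝒥X.J, 𝒥X.pushforward 𝒥Y p ≫ t = ∑ δ, 𝒥X.pushforward 𝒥X (act δ).hom := by
  haveI := hX.smoothOfRelativeDimension
  haveI := hY.smoothOfRelativeDimension
  obtain ⟨aX, πX, iX, lX, hiπX, hπiX, hlX, hαX⟩ := Albanese.exists_onePiece 𝒥X hX.geometricallyIrreducible
  obtain ⟨aY, πY, iY, lY, hiπY, hπiY, hlY, hαY⟩ := Albanese.exists_onePiece 𝒥Y hY.geometricallyIrreducible
  obtain ⟨T, hT⟩ := Albanese.exists_trace_of_isSepQuotient_complex (dX := dX) (dY := dY) hX.isProjectiveOver hY.isProjectiveOver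
    act p hp aX aY
  refine ⟨iY ≫ T ≫ πX, ?_⟩
  have hp' : 𝒥X.pushforward 𝒥Y p = iX ≫ aX.map aY p ≫ πY :=
    (Albanese.inj_comp_map_comp_proj_eq_pushforward 𝒥X 𝒥Y aX aY iX lX πY iY lY hlX hαX hlY hαY hiπY p).symm
  have hδ : ∀ δ, 𝒥X.pushforward 𝒥X (act δ).hom = iX ≫ aX.map aX (act δ).hom ≫ πX := fun δ =>
    (Albanese.inj_comp_map_comp_proj_eq_pushforward 𝒥X 𝒥X aX aX iX lX πX iX lX hlX hαX hlX hαX hiπX (act δ).hom).symm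
  calc 𝒥X.pushforward 𝒥Y p ≫ iY ≫ T ≫ πX
      = iX ≫ aX.map aY p ≫ (πY ≫ iY) ≫ T ≫ πX := by rw [hp']; simp only [Category.assoc]
    _ = iX ≫ (aX.map aY p ≫ T) ≫ πX := by rw [hπiY, Category.id_comp]; simp only [Category.assoc]
    _ = iX ≫ (∑ δ, aX.map aX (act δ).hom) ≫ πX := by rw [hT]
    _ = ∑ δ, iX ≫ aX.map aX (act δ).hom ≫ πX := by
        simp only [Preadditive.sum_comp, Preadditive.comp_sum]
    _ = ∑ δ, 𝒥X.pushforward 𝒥X (act δ).hom := Finset.sum_congr rfl fun δ _ => (hδ δ).symm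

/-! ## §4 The (F-P2) package of a Galois cover of complex curves -/

/-- **The three Galois letters of a cover of complex curves, PRODUCED** (given the named fact (F-P2) as a hypothesis): for a Galois
cover `p : X → Y = X/Δ` of smooth projective geometrically irreducible complex curves (`Δ` finite acting faithfully, `p` a quotient for
separated test objects), Jacobians `𝒥X`, `𝒥Y` (`dim J_Y ≥ 1`) and Riemann theta divisors `Θ_X`, `Θ_Y` defining the canonical principal
polarisations, there is `t : J_Y ⟶ J_X` (= `p^*`) with
(i) `Nm_p ≫ t = Σ_δ δ_*` (§3), (ii) `t ≫ Nm_p = |Δ| • 𝟙` (★ Q1 `comp_pushforward_eq_card_zsmul_of_isSmoothProjective`), and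
(iii) `ē_N^{Θ_X}(t P, Q) = ē_N^{Θ_Y}(P, Nm_p Q)` at every level (the named fact ★ `Jacobian.galoisCover_pullback_isWeilPairingAdjoint_norm`,
[LangeRodriguez2022] (3.3) «`\widehat{f^*} = Nm_f`», [Lange2023AbelianVarietiesComplex] (4.9)) — verbatim the `ht` / `hdeg` / `hq` hypotheses
of the level-adjoint calculus (★ `levelAdjoint_pushPull`). [cite: LangeRodriguez2022, §3.5.1 Prop. 3.5.1 (p. 65); §3.2.1 eq. (3.3) (pp. 46–47)]
[cite: Lang1983AbelianVarieties, Ch. VIII §6, Thm. 13 (pp. 224–227)] [cite: Lange2023AbelianVarietiesComplex, §4.5.2 eq. (4.9)] -/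
theorem Jacobian.exists_galoisCover_letters (hFP2 : Jacobian.galoisCover_pullback_isWeilPairingAdjoint_norm)
    {X Y : SchemeOver ℂ} (hX : IsSmoothProjective 1 X) (hY : IsSmoothProjective 1 Y) (𝒥X : Jacobian X) (𝒥Y : Jacobian Y)
    (hdim : 1 ≤ 𝒥Y.J.dim) {Δ : Type} [Group Δ] [Fintype Δ] (act : Δ →* Aut X) (hinj : Function.Injective act)
    (p : X ⟶ Y) (hp : IsSepQuotient (fun δ => act δ) p)
    {ΘX : CartierDivisor 𝒥X.J.X.left} {ΘY : CartierDivisor 𝒥Y.J.X.left}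
    (h1 : 𝒥X.IsRiemannThetaDivisor ΘX) (h2 : 𝒥X.J.IsPrincipalPolarizationDivisor ΘX)
    (h3 : 𝒥Y.IsRiemannThetaDivisor ΘY) (h4 : 𝒥Y.J.IsPrincipalPolarizationDivisor ΘY) :
    ∃ t : 𝒥Y.J ⟶ 𝒥X.J,
      𝒥X.pushforward 𝒥Y p ≫ t = ∑ δ, 𝒥X.pushforward 𝒥X (act δ).hom ∧
      t ≫ 𝒥X.pushforward 𝒥Y p = (Fintype.card Δ : ℤ) • 𝟙 𝒥Y.J ∧
      ∀ (N : ℕ) [IsDominant (AbelianVariety.Hom.toSchemeHom ((N : ℤ) • 𝟙 𝒥X.J))]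
        [IsDominant (AbelianVariety.Hom.toSchemeHom ((N : ℤ) • 𝟙 𝒥Y.J))]
        (P : 𝒥Y.J.torsionPoints ℂ N) (Q : 𝒥X.J.torsionPoints ℂ N),
        𝒥X.J.weilPairingLevel ΘX
            ⟨AlgPoints.map t.hom.hom.hom P.1, AbelianVariety.map_mem_torsionPoints t P.2⟩ Q =
          𝒥Y.J.weilPairingLevel ΘY P
            ⟨AlgPoints.map (𝒥X.pushforward 𝒥Y p).hom.hom.hom Q.1,
              AbelianVariety.map_mem_torsionPoints (𝒥X.pushforward 𝒥Y p) Q.2⟩ := by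
  obtain ⟨t, ht⟩ := Jacobian.exists_pushforward_comp_eq_sum (dX := 1) (dY := 1) hX hY 𝒥X 𝒥Y act p hp
  exact ⟨t, ht, 𝒥X.comp_pushforward_eq_card_zsmul_of_isSmoothProjective 𝒥Y (fun δ => act δ) p hX hp t ht,
    fun N _ _ P Q => hFP2 X Y hX hY 𝒥X 𝒥Y hdim Δ act hinj p hp ΘX ΘY h1 h2 h3 h4 t ht N P Q⟩

end Literature.NumberTheory.Automorphic.Liu2021.AppendixC

end
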